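import Mathlib.Analysis.InnerProductSpace.Basic
import Mathlib.Analysis.Normed.Operator.Basic
import HarnessLib

/-!
# Venture YMGap, track Y3 FLOW-DATA — SECOND-ORDER perturbation of a rank-one projection: the top eigenvalue of a
# self-adjoint operator `η`-close to `|e⟩⟨e|` is `⟪e, T e⟫ + ‖T e − ⟪e, T e⟫ e‖²` up to `4 η³` (theorems only)

HONEST FRAMING: venture file of the cell `pub-ymgap` (QuantumFields programme), track Y3 (FLOW-DATA); an abstract real-Hilbert-space
lemma, companion of the first-order statements `one_sub_le_norm_of_near_rankOne` / `norm_le_one_add_of_near_rankOne` of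
`FlowData/RectTubeKernelNearIdentity.lean`.  It is the operator-theoretic input of the SECOND-ORDER strong-coupling laws of
the tube (the `β²` coefficients of `ln λ₀`, `E_mag`, `E₁` on one-site tori), for which the first-order window
`1 − η ≤ ‖T‖ ≤ 1 + η` is too coarse.  No lattice object appears in this file; nothing about `L → ∞` or the continuum.

Let `T` be a bounded self-adjoint operator on a real Hilbert space with `‖T ψ − ⟪e, ψ⟫ e‖ ≤ η ‖ψ‖` for a unit vector `e`
(`0 ≤ η ≤ ¼`), and put `t = ⟪e, T e⟫`, `w = T e − t e` (the component of `T e` orthogonal to `e`; `‖w‖ ≤ η`, `|t − 1| ≤ η`).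

* `norm_sub_inner_smul_le` (`‖w‖ ≤ η`), `abs_inner_sub_one_le` (`|t − 1| ≤ η`), `abs_inner_apply_le_of_orthogonal`
  (`|⟪φ, T φ⟫| ≤ η ‖φ‖²` for `φ ⊥ e`);
* **`inner_add_norm_sq_sub_le_norm`** — the Rayleigh quotient of the trial vector `e + w`:
  `t + ‖w‖² − 2 η³ ≤ ‖T‖` (no eigenvector needed);
* **`norm_le_inner_add_norm_sq_add`** — if `T φ₀ = ‖T‖ φ₀` for a unit `φ₀` (a top eigenvector; for the tube operators it
  exists by compactness and positivity improvement), then `‖T‖ ≤ t + ‖w‖² + 4 η³` (the `2 × 2` block bound);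
* **`abs_norm_sub_second_order_le`** — together: `|‖T‖ − (⟪e, T e⟫ + ‖T e − ⟪e, T e⟫ e‖²)| ≤ 4 η³`, i.e. Rayleigh–Schrödinger
  to second order, `λ_max = 1 + A_{ee} + ‖Q A e‖² + O(‖A‖³)` for `T = |e⟩⟨e| + A`, with an explicit constant.

References: T. Kato, *Perturbation Theory for Linear Operators* (1966), §II.2 [cite: Kato1966, §II.2]; M. Reed, B. Simon IV (1978)
§XII.1 [cite: ReedSimonIV1978, §XII.1].
-/

noncomputable section

namespace Summit.Ventures.YMGap.FlowData

section SecondOrder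

variable {H : Type*} [NormedAddCommGroup H] [InnerProductSpace ℝ H]

/-- `‖T e − ⟪e, T e⟫ e‖ ≤ η`: the part of `T e` orthogonal to `e` is small (it is the orthogonal projection of `T e − e`).
[folklore] -/
theorem norm_sub_inner_smul_le (T : H →L[ℝ] H) {e : H} (he : ‖e‖ = 1) {η : ℝ}
    (hT : ∀ ψ, ‖T ψ - (@inner ℝ _ _ e ψ) • e‖ ≤ η * ‖ψ‖) :
    ‖T e - (@inner ℝ _ _ e (T e)) • e‖ ≤ η := by
  -- `w = v − ⟪e, v⟫ e` with `v = T e − e`, and `‖v − ⟪e,v⟫ e‖² = ‖v‖² − ⟪e,v⟫² ≤ ‖v‖²`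
  set v : H := T e - e with hv
  have hee : @inner ℝ _ _ e e = 1 := by rw [real_inner_self_eq_norm_sq, he, one_pow]
  have hw : T e - (@inner ℝ _ _ e (T e)) • e = v - (@inner ℝ _ _ e v) • e := by
    rw [hv, inner_sub_right, hee, sub_smul, one_smul]
    abel
  have hvη : ‖v‖ ≤ η := by
    have h := hT e
    rwa [hee, one_smul, he, mul_one] at h
  rw [hw]
  have hsq : ‖v - (@inner ℝ _ _ e v) • e‖ ^ 2 = ‖v‖ ^ 2 - (@inner ℝ _ _ e v) ^ 2 := by
    rw [@norm_sub_sq_real, norm_smul, he, mul_one, Real.norm_eq_abs, sq_abs, inner_smul_right, real_inner_comm]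
    ring
  have h0 : 0 ≤ η := (norm_nonneg _).trans hvη
  nlinarith [sq_nonneg (@inner ℝ _ _ e v), norm_nonneg (v - (@inner ℝ _ _ e v) • e), sq_nonneg (‖v‖ - η),
    mul_le_mul hvη hvη (norm_nonneg _) h0]

/-- `|⟪e, T e⟫ − 1| ≤ η`. [folklore] -/
theorem abs_inner_sub_one_le (T : H →L[ℝ] H) {e : H} (he : ‖e‖ = 1) {η : ℝ}
    (hT : ∀ ψ, ‖T ψ - (@inner ℝ _ _ e ψ) • e‖ ≤ η * ‖ψ‖) :
    |@inner ℝ _ _ e (T e) - 1| ≤ η := by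
  have hee : @inner ℝ _ _ e e = 1 := by rw [real_inner_self_eq_norm_sq, he, one_pow]
  have h := hT e
  rw [hee, one_smul, he, mul_one] at h
  have h2 : @inner ℝ _ _ e (T e) - 1 = @inner ℝ _ _ e (T e - e) := by rw [inner_sub_right, hee]
  rw [h2]
  have h3 := abs_real_inner_le_norm e (T e - e)
  rw [he, one_mul] at h3
  exact h3.trans h

/-- On the orthogonal complement of `e` the operator is small in quadratic form: `|⟪φ, T φ⟫| ≤ η ‖φ‖²` for `φ ⊥ e`.
[folklore] -/
theorem abs_inner_apply_le_of_orthogonal (T : H →L[ℝ] H) {e : H} {η : ℝ}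
    (hT : ∀ ψ, ‖T ψ - (@inner ℝ _ _ e ψ) • e‖ ≤ η * ‖ψ‖) {φ : H} (hφ : @inner ℝ _ _ e φ = 0) :
    |@inner ℝ _ _ φ (T φ)| ≤ η * ‖φ‖ ^ 2 := by
  have h := hT φ
  rw [hφ, zero_smul, sub_zero] at h
  calc |@inner ℝ _ _ φ (T φ)| ≤ ‖φ‖ * ‖T φ‖ := abs_real_inner_le_norm _ _
    _ ≤ ‖φ‖ * (η * ‖φ‖) := mul_le_mul_of_nonneg_left h (norm_nonneg _)
    _ = η * ‖φ‖ ^ 2 := by ring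

/-- **Lower Rayleigh bound (trial vector `e + w`)**: for self-adjoint `T` with `‖T ψ − ⟪e, ψ⟫ e‖ ≤ η ‖ψ‖` (`0 ≤ η`),
`⟪e, T e⟫ + ‖T e − ⟪e, T e⟫ e‖² − 2 η³ ≤ ‖T‖`. [cite: Kato1966, §II.2] -/
theorem inner_add_norm_sq_sub_le_norm (T : H →L[ℝ] H) (hsa : ∀ x y : H, @inner ℝ _ _ (T x) y = @inner ℝ _ _ x (T y))
    {e : H} (he : ‖e‖ = 1) {η : ℝ} (hη0 : 0 ≤ η)
    (hT : ∀ ψ, ‖T ψ - (@inner ℝ _ _ e ψ) • e‖ ≤ η * ‖ψ‖) :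
    @inner ℝ _ _ e (T e) + ‖T e - (@inner ℝ _ _ e (T e)) • e‖ ^ 2 - 2 * η ^ 3 ≤ ‖T‖ := by
  set t : ℝ := @inner ℝ _ _ e (T e) with ht
  set w : H := T e - t • e with hw
  have hee : @inner ℝ _ _ e e = 1 := by rw [real_inner_self_eq_norm_sq, he, one_pow]
  have hwη : ‖w‖ ≤ η := norm_sub_inner_smul_le T he hT
  have hew : @inner ℝ _ _ e w = 0 := by rw [hw, inner_sub_right, inner_smul_right, hee, mul_one, ← ht, sub_self]
  have hnormT : ‖T‖ ≤ 1 + η := by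
    -- (first-order upper bound, reproved to keep this file self-contained)
    refine ContinuousLinearMap.opNorm_le_bound T (by linarith) fun ψ => ?_
    have h1 : ‖(@inner ℝ _ _ e ψ) • e‖ ≤ ‖ψ‖ := by
      rw [norm_smul, he, mul_one]
      have := abs_real_inner_le_norm e ψ
      rwa [he, one_mul] at this
    calc ‖T ψ‖ = ‖(T ψ - (@inner ℝ _ _ e ψ) • e) + (@inner ℝ _ _ e ψ) • e‖ := by rw [sub_add_cancel]
      _ ≤ ‖T ψ - (@inner ℝ _ _ e ψ) • e‖ + ‖(@inner ℝ _ _ e ψ) • e‖ := norm_add_le _ _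
      _ ≤ η * ‖ψ‖ + ‖ψ‖ := add_le_add (hT ψ) h1
      _ = (1 + η) * ‖ψ‖ := by ring
  -- the trial vector
  set ψ : H := e + w with hψ
  have hψsq : ‖ψ‖ ^ 2 = 1 + ‖w‖ ^ 2 := by
    rw [hψ, @norm_add_sq_real, he, hew]; ring
  -- `⟪ψ, T ψ⟫ = t + 2 ‖w‖² + ⟪w, T w⟫`
  have hwTe : @inner ℝ _ _ w (T e) = ‖w‖ ^ 2 := by
    have : T e = w + t • e := by rw [hw]; abel
    rw [this, inner_add_right, inner_smul_right, real_inner_comm e w, hew, mul_zero, add_zero, real_inner_self_eq_norm_sq]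
  have hTew : @inner ℝ _ _ (T e) w = ‖w‖ ^ 2 := by rw [real_inner_comm w (T e)]; exact hwTe
  have heTw : @inner ℝ _ _ e (T w) = ‖w‖ ^ 2 := by rw [← hsa e w]; exact hTew
  have hform : @inner ℝ _ _ ψ (T ψ) = t + 2 * ‖w‖ ^ 2 + @inner ℝ _ _ w (T w) := by
    rw [hψ, map_add, inner_add_left, inner_add_right, inner_add_right, ← ht, heTw, hwTe]
    ring
  have hwTw : -(η * ‖w‖ ^ 2) ≤ @inner ℝ _ _ w (T w) := by
    have := abs_inner_apply_le_of_orthogonal T hT hew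
    exact (abs_le.1 this).1
  -- Rayleigh: `⟪ψ, Tψ⟫ ≤ ‖T‖ ‖ψ‖²`
  have hR : @inner ℝ _ _ ψ (T ψ) ≤ ‖T‖ * ‖ψ‖ ^ 2 := by
    calc @inner ℝ _ _ ψ (T ψ) ≤ ‖ψ‖ * ‖T ψ‖ := real_inner_le_norm _ _
      _ ≤ ‖ψ‖ * (‖T‖ * ‖ψ‖) := mul_le_mul_of_nonneg_left (T.le_opNorm ψ) (norm_nonneg _)
      _ = ‖T‖ * ‖ψ‖ ^ 2 := by ring
  rw [hform, hψsq] at hR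
  -- `‖T‖ ≥ t + (2 − η)‖w‖² − ‖T‖ ‖w‖² ≥ t + ‖w‖² − 2η ‖w‖²`
  have hw2 : ‖w‖ ^ 2 ≤ η ^ 2 := pow_le_pow_left₀ (norm_nonneg _) hwη 2
  nlinarith [hR, hwTw, hnormT, hw2, sq_nonneg ‖w‖, mul_nonneg hη0 (sq_nonneg ‖w‖),
    mul_le_mul_of_nonneg_left hw2 hη0]

/-- **Upper block bound (needs a top eigenvector)**: for self-adjoint `T` with `‖T ψ − ⟪e, ψ⟫ e‖ ≤ η ‖ψ‖` (`0 ≤ η ≤ ¼`) and a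
unit vector `φ₀` with `T φ₀ = ‖T‖ φ₀`, `‖T‖ ≤ ⟪e, T e⟫ + ‖T e − ⟪e, T e⟫ e‖² + 4 η³` (write `φ₀ = α e + φ`, `φ ⊥ e`:
`‖T‖ = ⟪φ₀, T φ₀⟫ ≤ (1 − s²) t + 2 s ‖w‖ + η s² ≤ t + ‖w‖²/(t − η)`, `s = ‖φ‖`). [cite: Kato1966, §II.2] -/
theorem norm_le_inner_add_norm_sq_add (T : H →L[ℝ] H) (hsa : ∀ x y : H, @inner ℝ _ _ (T x) y = @inner ℝ _ _ x (T y))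
    {e : H} (he : ‖e‖ = 1) {φ₀ : H} (h0 : ‖φ₀‖ = 1) (heig : T φ₀ = ‖T‖ • φ₀) {η : ℝ} (hη0 : 0 ≤ η) (hη : η ≤ 1 / 4)
    (hT : ∀ ψ, ‖T ψ - (@inner ℝ _ _ e ψ) • e‖ ≤ η * ‖ψ‖) :
    ‖T‖ ≤ @inner ℝ _ _ e (T e) + ‖T e - (@inner ℝ _ _ e (T e)) • e‖ ^ 2 + 4 * η ^ 3 := by
  set t : ℝ := @inner ℝ _ _ e (T e) with ht
  set w : H := T e - t • e with hw
  have hee : @inner ℝ _ _ e e = 1 := by rw [real_inner_self_eq_norm_sq, he, one_pow]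
  have hwη : ‖w‖ ≤ η := norm_sub_inner_smul_le T he hT
  have hew : @inner ℝ _ _ e w = 0 := by rw [hw, inner_sub_right, inner_smul_right, hee, mul_one, ← ht, sub_self]
  have ht1 : |t - 1| ≤ η := abs_inner_sub_one_le T he hT
  -- decompose the eigenvector
  set α : ℝ := @inner ℝ _ _ e φ₀ with hα
  set φ : H := φ₀ - α • e with hφ
  have heφ : @inner ℝ _ _ e φ = 0 := by rw [hφ, inner_sub_right, inner_smul_right, hee, mul_one, ← hα, sub_self]
  have hdec : φ₀ = α • e + φ := by rw [hφ]; abel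
  have hnorm : α ^ 2 + ‖φ‖ ^ 2 = 1 := by
    have h1 : ‖φ₀‖ ^ 2 = ‖α • e + φ‖ ^ 2 := by rw [← hdec]
    rw [h0, one_pow, @norm_add_sq_real, norm_smul, he, mul_one, Real.norm_eq_abs, sq_abs, inner_smul_left, heφ] at h1
    simp only [RCLike.conj_to_real, mul_zero, add_zero] at h1
    linarith
  -- `‖T‖ = ⟪φ₀, T φ₀⟫`
  have hTq : ‖T‖ = @inner ℝ _ _ φ₀ (T φ₀) := by
    rw [heig, inner_smul_right, real_inner_self_eq_norm_sq, h0, one_pow, mul_one]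
  -- expand the quadratic form
  have hφTe : @inner ℝ _ _ φ (T e) = @inner ℝ _ _ φ w := by
    have : T e = w + t • e := by rw [hw]; abel
    rw [this, inner_add_right, inner_smul_right, real_inner_comm e φ, heφ, mul_zero, add_zero]
  have hTeφ : @inner ℝ _ _ (T e) φ = @inner ℝ _ _ φ w := by rw [real_inner_comm φ (T e)]; exact hφTe
  have heTφ : @inner ℝ _ _ e (T φ) = @inner ℝ _ _ φ w := by rw [← hsa e φ]; exact hTeφ
  have hform : @inner ℝ _ _ φ₀ (T φ₀) = α ^ 2 * t + 2 * α * @inner ℝ _ _ φ w + @inner ℝ _ _ φ (T φ) := by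
    rw [hdec, map_add, map_smul, inner_add_left, inner_add_right, inner_add_right, inner_smul_left, inner_smul_left,
      inner_smul_right, inner_smul_right, ← ht, heTφ, hφTe]
    simp only [RCLike.conj_to_real]
    ring
  have hφTφ : @inner ℝ _ _ φ (T φ) ≤ η * ‖φ‖ ^ 2 := (abs_le.1 (abs_inner_apply_le_of_orthogonal T hT heφ)).2
  have hφw : |@inner ℝ _ _ φ w| ≤ ‖φ‖ * ‖w‖ := abs_real_inner_le_norm _ _
  -- `‖T‖ ≤ (1 − s²) t + 2 s ‖w‖ + η s²` with `s = ‖φ‖`, `|α| ≤ 1`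
  have hα1 : |α| ≤ 1 := by
    have := abs_real_inner_le_norm e φ₀
    rwa [he, h0, one_mul] at this
  have hs : ‖T‖ ≤ (1 - ‖φ‖ ^ 2) * t + 2 * ‖φ‖ * ‖w‖ + η * ‖φ‖ ^ 2 := by
    rw [hTq, hform]
    have h1 : 2 * α * @inner ℝ _ _ φ w ≤ 2 * ‖φ‖ * ‖w‖ := by
      have h2 : |2 * α * @inner ℝ _ _ φ w| ≤ 2 * 1 * (‖φ‖ * ‖w‖) := by
        rw [abs_mul, abs_mul, abs_two]
        exact mul_le_mul (mul_le_mul_of_nonneg_left hα1 zero_le_two) hφw (abs_nonneg _) (by positivity)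
      have := (abs_le.1 h2).2
      linarith
    have h3 : α ^ 2 = 1 - ‖φ‖ ^ 2 := by linarith
    rw [h3]
    linarith
  -- maximise in `s`: `(1 − s²) t + 2 s ‖w‖ + η s² = t − (t − η) s² + 2 ‖w‖ s ≤ t + ‖w‖²/(t − η)`, `t − η ≥ 1 − 2η ≥ 1/2`
  have htη : 1 / 2 ≤ t - η := by
    have := (abs_le.1 ht1).1
    linarith
  have hmax : (1 - ‖φ‖ ^ 2) * t + 2 * ‖φ‖ * ‖w‖ + η * ‖φ‖ ^ 2 ≤ t + ‖w‖ ^ 2 / (t - η) := by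
    have hc : 0 < t - η := by linarith
    have key : 0 ≤ (t - η) * ‖φ‖ ^ 2 - 2 * ‖φ‖ * ‖w‖ + ‖w‖ ^ 2 / (t - η) := by
      have : (t - η) * ‖φ‖ ^ 2 - 2 * ‖φ‖ * ‖w‖ + ‖w‖ ^ 2 / (t - η) = ((t - η) * ‖φ‖ - ‖w‖) ^ 2 / (t - η) := by
        field_simp
        ring
      rw [this]
      positivity
    linarith
  -- `‖w‖²/(t − η) ≤ ‖w‖² (1 + 4η) ≤ ‖w‖² + 4 η³`
  have hw2 : ‖w‖ ^ 2 ≤ η ^ 2 := pow_le_pow_left₀ (norm_nonneg _) hwη 2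
  have hinv : ‖w‖ ^ 2 / (t - η) ≤ ‖w‖ ^ 2 * (1 + 4 * η) := by
    rw [div_le_iff₀ (by linarith)]
    have h1 : 1 ≤ (1 + 4 * η) * (t - η) := by
      have := (abs_le.1 ht1).1
      nlinarith
    nlinarith [sq_nonneg ‖w‖]
  calc ‖T‖ ≤ t + ‖w‖ ^ 2 / (t - η) := hs.trans hmax
    _ ≤ t + ‖w‖ ^ 2 * (1 + 4 * η) := by linarith
    _ = t + ‖w‖ ^ 2 + 4 * (η * ‖w‖ ^ 2) := by ring
    _ ≤ t + ‖w‖ ^ 2 + 4 * η ^ 3 := by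
        have : η * ‖w‖ ^ 2 ≤ η ^ 3 := by nlinarith
        linarith

/-- **SECOND-ORDER PERTURBATION OF A RANK-ONE PROJECTION.**  Let `T` be bounded self-adjoint on a real Hilbert space with
`‖T ψ − ⟪e, ψ⟫ e‖ ≤ η ‖ψ‖` (`‖e‖ = 1`, `0 ≤ η ≤ ¼`) and let `T φ₀ = ‖T‖ φ₀` for a unit vector `φ₀`.  Then
`|‖T‖ − (⟪e, T e⟫ + ‖T e − ⟪e, T e⟫ e‖²)| ≤ 4 η³` — with `T = |e⟩⟨e| + A`: `λ_max(T) = 1 + ⟪e, A e⟫ + ‖Q A e‖² + O(‖A‖³)`,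
`Q = 1 − |e⟩⟨e|`, the Rayleigh–Schrödinger series to second order with an explicit remainder. [cite: Kato1966, §II.2] -/
theorem abs_norm_sub_second_order_le (T : H →L[ℝ] H) (hsa : ∀ x y : H, @inner ℝ _ _ (T x) y = @inner ℝ _ _ x (T y))
    {e : H} (he : ‖e‖ = 1) {φ₀ : H} (h0 : ‖φ₀‖ = 1) (heig : T φ₀ = ‖T‖ • φ₀) {η : ℝ} (hη0 : 0 ≤ η) (hη : η ≤ 1 / 4)
    (hT : ∀ ψ, ‖T ψ - (@inner ℝ _ _ e ψ) • e‖ ≤ η * ‖ψ‖) :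
    |‖T‖ - (@inner ℝ _ _ e (T e) + ‖T e - (@inner ℝ _ _ e (T e)) • e‖ ^ 2)| ≤ 4 * η ^ 3 := by
  have h1 := inner_add_norm_sq_sub_le_norm T hsa he hη0 hT
  have h2 := norm_le_inner_add_norm_sq_add T hsa he h0 heig hη0 hη hT
  have hη3 : 0 ≤ η ^ 3 := pow_nonneg hη0 3
  rw [abs_le]
  constructor <;> linarith

end SecondOrder

end Summit.Ventures.YMGap.FlowData
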